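import Summits.AtomisticToContinuum.Crystallization.Theorems.ChartedZeroExcessLayeredLatticeLiouvilleTM

/-!
# Zero-excess layered lattice Liouville — part TN (lens-2 g38): ERRATUM (T) + (Σ) to the bond-isomorphism sub-line (A0⁺) … (Λ♭) of parts
TG–TL, and its RE-TYPING (free output frame · explicit quadratic-excess input · two conformality tolerances `s ≤ s'`)

## The erratum (paper level; memo `ERRATUM-g38-TiltAndObliqueStrain.md`)
Two mechanisms refute, at the column's literals `(aHi; Λ, θ, s) = (1; 2, 1/16, 1/50)`, every piece of the sub-line that OUTPUTS a bond-isomorphic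
equilibrium chart from registration data (all of them are valid implications with a false leaf, so the columns `_16XH9 … _16XH15` through
them do not prove the summit; the columns `_16XH6*`, `_16XH7*`, `_16BG*` and the node (A0) `GlobalChartRegistrationP` itself are NOT affected):
(T) FRAME TILT — kills the pieces whose output chart is PINNED to the lattice `L` of the scale-`R` datum: (A0♭⁺′) `EquilChartBondIsoPinnedP`, (B2)
`BondIsoPinningP`, (G) `GradPinningP`, (G♯) `GradPinningThickP`, (G♭) `GradPinningThinP`, (Λ♭) `ThinLaunderingP`.  A window of relaxed fcc far below ONE
intrinsic stacking fault (plane family `Π`, height `H_f`) is registered, at every scale and at level `η ≥ 16·H_f⁻⁸` resp. with the fault slab affordable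
(`≈ 13·D² ≤ 6.5·η·D³` once `D ≥ 2/η ≤ H_f − 4`), by the perfect fcc chart READ ALONG A DIFFERENT {111} FAMILY `Π′` (cubic ambiguity of an all-`c` window:
`L = d⋆·Q′`, layer plane `Π′`); every `LayeredHom L w₁` is `Π′`-layered, a bijective bond isomorphism `S → LayeredHom L w₁` must carry `S`'s `h`-layers
(`Π`-planes) to the chart's `h`-layers (`Π′`-planes), so on the perfect region it is an affine symmetry `A` with linear part `g ≠ 1` (`g Π = Π′`) and
clause (i) of `IsRegistered` costs `|(1 − g)b|² ≥ 1/4` on `≥ 8` of the `12` bonds at EVERY window site: `Σ τ₁² ≥ c·nK ≫ C♭·η·nK`.  For (Λ♭) the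
same-layer clause fails at the good sites (the registering map and the bond isomorphism induce different layer partitions of the window).
(Σ) OBLIQUE NORMAL STRAIN — kills, in addition, the FRAME-FREE forms (A0⁺) `GlobalChartIsoRegistrationP`, (A0♭⁺) `EquilChartBondIsoP` (and any «∃ L₁»
rewording of the pinned pieces) on the GSC-free P-door at output tolerance = input tolerance: the same `S`, homogeneously strained by `ε = 2.5 %`
along the normal `n′` of `Π′` (clean: two-shell displacements `≤ 0.035·a < a/16`; Nash: homogeneous Bravais + local fault relaxation, resolved shear on
`Π` `≈ 0.8 %`; charted; θ-good with the strained frame), leaves the `Π′`-planes UNSTRAINED, so the `Π′`-reading charts are EXACTLY conformal about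
`a := d⋆` — the strain sits in the free offsets `w` (`IsEquilChart` constrains `L` only: in-plane metric; gaps and registry are free, g28 part P «`w` is
not pinned», g36 F1 «stress freedom») — and the multi-scale hypothesis holds at every scale as in (T); but a bond-isomorphic chart must read the TRUE
family `Π`, whose in-plane lattice is stretched by `(8/9)·ε = 2.2 % > s = 2 %` along `n′` projected to `Π`: `‖L₁ − a·Q‖ ≥ 0.022·a` for every isometry
`Q`, `IsConfChart a (1/50) L₁` fails (choose the level `η ≤ 10⁻⁸/C♭` so that the conclusion's registration is not vacuous and forces the chart's
in-plane lattice within `0.03 %` of `S`'s).  (A0) survives both ((A0)'s map is only tear-free: the layerwise shift `x ↦ x − s_f` above the fault is a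
tear-free bijection onto the tilted chart at affordable levels).  SAFE pieces: (B1) `WordTransplantP`, (B4) (proved), (P) (proved), (Υ) `LateralUntwistP`
(its pointwise layer-compatibility hypothesis excludes the tilt), (Υc), (Υb), (A0♯⁺) `BondIsoLevelsP` (hypothesis side).
ROOT CAUSE.  The registration currency is IN-PLANE: it forgets (a) which {111} family of a locally cubic window the chart reads and (b) the normal
strain.  (a) is cured by FREEING THE OUTPUT FRAME (`∃ L₁`), (b) only by ENERGY: on e⋆-GSC door sets `excess_window_le_of_gsc` (BindingSurface, PROVED)
bounds the window excess by `C₁·D²`, hence the homogeneous 3D strain of `win D` by `≲ √(C₁/D)` — so the oblique strain of (Σ) is impossible at large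
scales, up to an `O(R^{-1/2})` anisotropic remainder that an output tolerance `s' > s` absorbs (at `s' = s` a hair remains when `|d⋆/a − 1| = s` exactly).
## The re-typing (this file; every seam PROVED, placeholder-free)
Every re-typed piece («…X», structural-dichotomy reading GENERIC = `h`-letters in reach pin the reading, SPECIAL = all-`c` window needs re-framing)
takes the explicit ENERGY input `HasQuadExcess C₁ S` (`∀ D ≥ 1, excess(win D) ≤ C₁·D²`; `∀ C₁ ≥ 0` in the constants prefix; discharged at the PG glue
site by `excess_window_le_of_gsc`), keeps the registration hypotheses at tolerance `s`, and concludes with a FREE equilibrium chart `∃ L₁ w₁` at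
tolerance `s'`: (A0ˣ) `GlobalChartRegistrationPX` [node] ⟸ (A0⁺ˣ) `GlobalChartIsoRegistrationPX` ⟸ (A0♭⁺ˣ) `EquilChartBondIsoPX` ∧ (A0♯⁺)(s′) ⟸
(B1)(s) ∧ (B2ˣ) `BondIsoReframingP` ∧ (B4);  (B2ˣ) ⟸ (Gˣ) `GradReframingP` ∧ (P);  (Gˣ) ⟸ (G♯ˣ) `GradReframingThickP` ∧ (G♭ˣ) `GradReframingThinP`;
(G♭ˣ) ⟸ (Λ♭ˣ) `ThinLaunderingPX` ∧ (Υ)(s′).  NOTHING LOST: each refuted pinned piece implies its re-typing (`…_of_pinned` projections, PROVED), and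
(A0)(s′) ⇒ (A0ˣ)(s, s′).  The spine re-enters ABOVE (A0): (HC) `HarmonicContractionPGLms aHi Λ θ s` has a tolerance-free conclusion and the PG door, so
part TO proves it from (A0ˣ)(s, s′) and the existing consumer leaves at `s′` (nine-piece glue re-proved), and the column `_16XH16` runs the producers
(Z_E), (P), (B1) at `s = 1/100` and everything else at `s′ = 1/50`.  0 EQUIV; placeholder-free; no type-class declarations, custom syntax or option pragmas.
-/

noncomputable section

open scoped BigOperators InnerProductSpace RealInnerProductSpace
open MeasureTheory Set Metric Filter Topology
open Summit.AtomisticToContinuum.Crystallization.Theorems.ChartedPlanarOrderRigidityDoor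
  (E3 IsClean IsNash IsCharted IsEStarGSC VisibleGap PertRegime atomsIn siteEnergy eStar BindingSurface)
open Summit.AtomisticToContinuum.Crystallization.Theorems.ChartedPlanarOrderDensityDichotomy (μS IsSep nK nK_nonneg excess)
open Summit.AtomisticToContinuum.Crystallization.Theorems.ChartedPlanarOrderMesoCut (IsDoorSet NearHom LayeredHom layerOf EnvClose)
open Summit.AtomisticToContinuum.Crystallization.Theorems.ChartedPlanarOrderDoorLayered
  (TwoPeriodic DoorPeriodic PeriodicBulkGapDoor NearHomL2BD Layered atomsIn_subset)
open Summit.AtomisticToContinuum.Crystallization.Theorems.ChartedPlanarOrderDoorLayeredOsc (IsTwoShellAffineGood DoorPeriodicOsc)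
open Summit.AtomisticToContinuum.Crystallization.Theorems.ChartedPlanarOrderCleanScaleP
  (IsCleanP IsDoorSetP DoorPeriodicP isDoorSetP_one_iff isCleanP_one_iff isCleanP_μS_iff)
open Literature.MathematicalPhysics.StatisticalMechanics (lennardJones IsHaggSeq triangularVec₁ triangularVec₂)
open Literature.Geometry.DiscreteGeometry (IsTwoShellGoodSet)

namespace Summit.AtomisticToContinuum.Crystallization.Theorems.ChartedZeroExcessLayeredLatticeLiouville

/-! ## §XV  (lens-2 g38) ERRATUM (T) + (Σ) and the re-typed bond-isomorphism sub-line

### XV.1  The energy input and tolerance monotonicity -/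

/-- **quadratic (surface-order) excess growth** of the root's windows: `excess(win D) ≤ C₁·D²` for `D ≥ 1` — the conclusion of BindingSurface, as an
explicit, GSC-free hypothesis of the re-typed pieces (it excludes the homogeneously strained witnesses of (Σ) at large scales). [this file, g38] -/
def HasQuadExcess (C₁ : ℝ) (S : Set E3) : Prop :=
  ∀ D : ℝ, 1 ≤ D → excess S (atomsIn (μS S) 0 D) ≤ C₁ * D ^ 2

/-- on e⋆-GSC door sets the energy input holds with BindingSurface's constant (PROVED: `excess_window_le_of_gsc`). [this file, g38] -/
theorem hasQuadExcess_of_isDoorSetPG {δ : ℝ} (hδ : 0 < δ) :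
    ∃ C₁ : ℝ, 0 ≤ C₁ ∧ ∀ aHi : ℝ, ∀ S : Set E3, IsDoorSetPG aHi δ S → HasQuadExcess C₁ S := by
  obtain ⟨C₁, hC₁, h⟩ := excess_window_le_of_gsc hδ
  exact ⟨C₁, hC₁, fun aHi S hS D hD => h aHi S hS D hD⟩

/-- non-vacuity of the energy input: it is monotone in the constant. [this file, g38] -/
theorem HasQuadExcess.mono {C₁ C₂ : ℝ} (h12 : C₁ ≤ C₂) {S : Set E3} (h : HasQuadExcess C₁ S) : HasQuadExcess C₂ S :=
  fun D hD => (h D hD).trans (mul_le_mul_of_nonneg_right h12 (sq_nonneg D))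

/-- equilibrium charts are monotone in the conformality tolerance. [this file, g38] -/
theorem IsEquilChart.of_tol {a s s' Λ : ℝ} {L : E3 ≃L[ℝ] E3} {w : ℤ → E3} (h : IsEquilChart a s Λ L w) (hs : s ≤ s') (ha : 0 ≤ a) :
    IsEquilChart a s' Λ L w := by
  obtain ⟨h1, h2, hc, h4, h5⟩ := h
  exact ⟨h1, h2, hc.mono hs ha, h4, h5⟩

/-! ### XV.2  The re-typed pieces (free output frame, energy input, tolerances `s ↦ s'`) -/

/-- ★★ **(A0ˣ) «GlobalChartRegistrationPX aHi Λ θ s s'»** — the NODE beneath (HC) replacing (A0) on the bond-isomorphism line: (A0) with the explicit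
energy input `HasQuadExcess C₁ S` (constants may depend on `C₁`) and the output equilibrium chart at tolerance `s'` (hypotheses at `s`).  (A0)(s′) ∧ `s ≤ s′`
⇒ (A0ˣ)(s,s′) (PROVED), so nothing of architecture (II) is lost; part TO proves (HC)(s) from (A0ˣ)(s,s′) and the consumer leaves at `s′`.  EXISTENCE ·
UNDECIDED (as (A0)). [this file, g38] -/
def GlobalChartRegistrationPX (aHi Λ θ s s' : ℝ) : Prop :=
  ∀ δ : ℝ, 0 < δ → ∀ a : ℝ, 0 < a → ∀ C₁ : ℝ, 0 ≤ C₁ → ∃ Cg : ℝ, 1 ≤ Cg ∧ ∃ η₁ : ℝ, 0 < η₁ ∧ ∃ R₁ : ℝ, 0 < R₁ ∧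
    ∀ S : Set E3, IsDoorSetP aHi δ S → (∀ q ∈ S, IsTwoShellAffineGood θ S q) → HasQuadExcess C₁ S →
      ∀ η : ℝ, 0 < η → η ≤ η₁ → ∀ R : ℝ, R₁ ≤ R →
        (∀ D : ℝ, R ≤ D → NearHomH1BDE a s Λ η 4 D S (atomsIn (μS S) 0 D)) →
          ∃ (L : E3 ≃L[ℝ] E3) (w : ℤ → E3), IsEquilChart a s' Λ L w ∧
            ∃ Ψ : E3 → E3, IsGlobalReg Cg η R S (LayeredHom (L : E3 →L[ℝ] E3) w) Ψ

/-- ★★ **(A0⁺ˣ) «GlobalChartIsoRegistrationPX aHi Λ θ s s'»** — re-typed (A0⁺): the global registration is a BOND ISOMORPHISM onto a free equilibrium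
chart at tolerance `s'`, given the energy input.  (Σ) is excluded by `HasQuadExcess` at scales `R ≥ R₁(C₁, s′ − s)`, (T) by the free frame.
EXISTENCE + ESTIMATE · UNDECIDED · TRUE-expected for `s < s′`. [this file, g38] -/
def GlobalChartIsoRegistrationPX (aHi Λ θ s s' : ℝ) : Prop :=
  ∀ δ : ℝ, 0 < δ → ∀ a : ℝ, 0 < a → ∀ C₁ : ℝ, 0 ≤ C₁ → ∃ Cg : ℝ, 1 ≤ Cg ∧ ∃ η₁ : ℝ, 0 < η₁ ∧ ∃ R₁ : ℝ, 0 < R₁ ∧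
    ∀ S : Set E3, IsDoorSetP aHi δ S → (∀ q ∈ S, IsTwoShellAffineGood θ S q) → HasQuadExcess C₁ S →
      ∀ η : ℝ, 0 < η → η ≤ η₁ → ∀ R : ℝ, R₁ ≤ R →
        (∀ D : ℝ, R ≤ D → NearHomH1BDE a s Λ η 4 D S (atomsIn (μS S) 0 D)) →
          ∃ (L : E3 ≃L[ℝ] E3) (w : ℤ → E3), IsEquilChart a s' Λ L w ∧
            ∃ Ψ : E3 → E3, IsGlobalReg Cg η R S (LayeredHom (L : E3 →L[ℝ] E3) w) Ψ ∧ IsBondIso S Ψ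

/-- ★★ **(A0♭⁺ˣ) «EquilChartBondIsoPX aHi Λ θ s s'»** — re-typed existence half (A0♭⁺): ONE free equilibrium chart at tolerance `s'` and ONE map that is a
bijective bond isomorphism, two-sided tear-free, registering `win R` at level `C♭·η`, given the energy input.  EXISTENCE + PINNING · UNDECIDED ·
TRUE-expected for `s < s′`. [this file, g38] -/
def EquilChartBondIsoPX (aHi Λ θ s s' : ℝ) : Prop :=
  ∀ δ : ℝ, 0 < δ → ∀ a : ℝ, 0 < a → ∀ C₁ : ℝ, 0 ≤ C₁ → ∃ Cb : ℝ, 1 ≤ Cb ∧ ∃ η₁ : ℝ, 0 < η₁ ∧ ∃ R₁ : ℝ, 0 < R₁ ∧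
    ∀ S : Set E3, IsDoorSetP aHi δ S → (∀ q ∈ S, IsTwoShellAffineGood θ S q) → HasQuadExcess C₁ S →
      ∀ η : ℝ, 0 < η → η ≤ η₁ → ∀ R : ℝ, R₁ ≤ R →
        (∀ D : ℝ, R ≤ D → NearHomH1BDE a s Λ η 4 D S (atomsIn (μS S) 0 D)) →
          ∃ (L : E3 ≃L[ℝ] E3) (w : ℤ → E3), IsEquilChart a s' Λ L w ∧
            ∃ Ψ₀ : E3 → E3, Set.BijOn Ψ₀ S (LayeredHom (L : E3 →L[ℝ] E3) w) ∧ IsBondIso S Ψ₀ ∧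
              (∀ x ∈ S, ∀ p ∈ S, dist p x ≤ 4 → dist (Ψ₀ p) (Ψ₀ x) ≤ 8) ∧ (∀ x ∈ S, ∀ p ∈ S, dist (Ψ₀ p) (Ψ₀ x) ≤ 4 → dist p x ≤ 8) ∧
              ∃ τ : E3 → ℝ, IsRegistered (Cb * η) 4 R S (atomsIn (μS S) 0 R) (LayeredHom (L : E3 →L[ℝ] E3) w) Ψ₀ τ

/-- ★★ **(B2ˣ) «BondIsoReframingP aHi Λ θ s s'»** — re-typed (B2) `BondIsoPinningP`: GIVEN the scale-`R` datum `(L, w′, Ψ′, τ′)` at tolerance `s` and a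
bijective bond isomorphism `Ψ₀ : S → LayeredHom L w` onto an equilibrium chart on the datum's lattice (what (B1) + D1 produce), there is a RE-FRAMED
equilibrium chart `LayeredHom L₁ w₁` — `L₁` FREE (intended: `L₁ = L` when `S` has an `h`-letter in reach, `L₁ = L ∘ ĝ` with `ĝ` a point symmetry of the
cubic germ otherwise), tolerance `s'` — and a bijective bond isomorphism `Ψ₁ : S → LayeredHom L₁ w₁` registering `win R` at level `C♭·η`; energy input
given.  PINNING / RIGIDITY ESTIMATE + RE-FRAMING · TRUE-expected (`s < s′`) · ATTACKABLE · M–L.  Why it might fail: the re-framed chart's in-plane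
lattice is `S`'s TRUE-plane lattice, conformal about `a` only within `s + C·(C₁/R)^{1/2}` — needs the floor `R₁ ≳ C₁/(s′−s)²`; at `s′ = s` refuted-hair.
Sources: [this tree: `BondIsoPinningP` (TH), `excess_window_le_of_gsc` (N), `IsConfChart.apply_bounds` (O)], [kruzik2019 p.55 Thm 1.1.12],
[ConwaySloane1999 Ch. 1 §1.3]. [this file, g38] -/
def BondIsoReframingP (aHi Λ θ s s' : ℝ) : Prop :=
  ∀ δ : ℝ, 0 < δ → ∀ a : ℝ, 0 < a → ∀ C₁ : ℝ, 0 ≤ C₁ → ∃ Cb : ℝ, 1 ≤ Cb ∧ ∃ η₁ : ℝ, 0 < η₁ ∧ ∃ R₁ : ℝ, 0 < R₁ ∧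
    ∀ S : Set E3, IsDoorSetP aHi δ S → (∀ q ∈ S, IsTwoShellAffineGood θ S q) → HasQuadExcess C₁ S →
      ∀ η : ℝ, 0 < η → η ≤ η₁ → ∀ R : ℝ, R₁ ≤ R →
        (∀ D : ℝ, R ≤ D → NearHomH1BDE a s Λ η 4 D S (atomsIn (μS S) 0 D)) →
          ∀ (L : E3 ≃L[ℝ] E3) (w' : ℤ → E3) (Ψ' : E3 → E3) (τ' : E3 → ℝ), IsEquilChart a s Λ L w' →
            IsRegistered η 4 R S (atomsIn (μS S) 0 R) (LayeredHom (L : E3 →L[ℝ] E3) w') Ψ' τ' →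
              ∀ (w : ℤ → E3) (Ψ₀ : E3 → E3), IsEquilChart a s Λ L w → Set.BijOn Ψ₀ S (LayeredHom (L : E3 →L[ℝ] E3) w) → IsBondIso S Ψ₀ →
                ∃ (L₁ : E3 ≃L[ℝ] E3) (w₁ : ℤ → E3) (Ψ₁ : E3 → E3), IsEquilChart a s' Λ L₁ w₁ ∧
                  Set.BijOn Ψ₁ S (LayeredHom (L₁ : E3 →L[ℝ] E3) w₁) ∧ IsBondIso S Ψ₁ ∧
                    ∃ τ₁ : E3 → ℝ, IsRegistered (Cb * η) 4 R S (atomsIn (μS S) 0 R) (LayeredHom (L₁ : E3 →L[ℝ] E3) w₁) Ψ₁ τ₁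

/-- ★★ **(Gˣ) «GradReframingP aHi Λ θ s s'»** — re-typed (G): (B2ˣ) with the position clause at a free scale `ρ` ((P) re-anchors). [this file, g38] -/
def GradReframingP (aHi Λ θ s s' : ℝ) : Prop :=
  ∀ δ : ℝ, 0 < δ → ∀ a : ℝ, 0 < a → ∀ C₁ : ℝ, 0 ≤ C₁ → ∃ Cb : ℝ, 1 ≤ Cb ∧ ∃ η₁ : ℝ, 0 < η₁ ∧ ∃ R₁ : ℝ, 0 < R₁ ∧
    ∀ S : Set E3, IsDoorSetP aHi δ S → (∀ q ∈ S, IsTwoShellAffineGood θ S q) → HasQuadExcess C₁ S →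
      ∀ η : ℝ, 0 < η → η ≤ η₁ → ∀ R : ℝ, R₁ ≤ R →
        (∀ D : ℝ, R ≤ D → NearHomH1BDE a s Λ η 4 D S (atomsIn (μS S) 0 D)) →
          ∀ (L : E3 ≃L[ℝ] E3) (w' : ℤ → E3) (Ψ' : E3 → E3) (τ' : E3 → ℝ), IsEquilChart a s Λ L w' →
            IsRegistered η 4 R S (atomsIn (μS S) 0 R) (LayeredHom (L : E3 →L[ℝ] E3) w') Ψ' τ' →
              ∀ (w : ℤ → E3) (Ψ₀ : E3 → E3), IsEquilChart a s Λ L w → Set.BijOn Ψ₀ S (LayeredHom (L : E3 →L[ℝ] E3) w) → IsBondIso S Ψ₀ →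
                ∃ (L₁ : E3 ≃L[ℝ] E3) (w₁ : ℤ → E3) (Ψ₁ : E3 → E3), IsEquilChart a s' Λ L₁ w₁ ∧
                  Set.BijOn Ψ₁ S (LayeredHom (L₁ : E3 →L[ℝ] E3) w₁) ∧ IsBondIso S Ψ₁ ∧
                    ∃ (ρ : ℝ) (τ₁ : E3 → ℝ), IsRegistered (Cb * η) 4 ρ S (atomsIn (μS S) 0 R) (LayeredHom (L₁ : E3 →L[ℝ] E3) w₁) Ψ₁ τ₁

/-- ★★ **(G♯ˣ) «GradReframingThickP aHi Λ θ s s'»** — re-typed (G♯): (Gˣ) in the incoherent regime `c₀ ≤ η·R²` (every `c₀ > 0`).  TAME EXISTENCE (tension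
retune at fixed true word) + TRANSFER + RE-FRAMING · TRUE-expected (`s < s′`) · ATTACKABLE · L. [this file, g38] -/
def GradReframingThickP (aHi Λ θ s s' : ℝ) : Prop :=
  ∀ c₀ : ℝ, 0 < c₀ → ∀ δ : ℝ, 0 < δ → ∀ a : ℝ, 0 < a → ∀ C₁ : ℝ, 0 ≤ C₁ → ∃ Cb : ℝ, 1 ≤ Cb ∧ ∃ η₁ : ℝ, 0 < η₁ ∧ ∃ R₁ : ℝ, 0 < R₁ ∧
    ∀ S : Set E3, IsDoorSetP aHi δ S → (∀ q ∈ S, IsTwoShellAffineGood θ S q) → HasQuadExcess C₁ S →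
      ∀ η : ℝ, 0 < η → η ≤ η₁ → ∀ R : ℝ, R₁ ≤ R → c₀ ≤ η * R ^ 2 →
        (∀ D : ℝ, R ≤ D → NearHomH1BDE a s Λ η 4 D S (atomsIn (μS S) 0 D)) →
          ∀ (L : E3 ≃L[ℝ] E3) (w' : ℤ → E3) (Ψ' : E3 → E3) (τ' : E3 → ℝ), IsEquilChart a s Λ L w' →
            IsRegistered η 4 R S (atomsIn (μS S) 0 R) (LayeredHom (L : E3 →L[ℝ] E3) w') Ψ' τ' →
              ∀ (w : ℤ → E3) (Ψ₀ : E3 → E3), IsEquilChart a s Λ L w → Set.BijOn Ψ₀ S (LayeredHom (L : E3 →L[ℝ] E3) w) → IsBondIso S Ψ₀ →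
                ∃ (L₁ : E3 ≃L[ℝ] E3) (w₁ : ℤ → E3) (Ψ₁ : E3 → E3), IsEquilChart a s' Λ L₁ w₁ ∧
                  Set.BijOn Ψ₁ S (LayeredHom (L₁ : E3 →L[ℝ] E3) w₁) ∧ IsBondIso S Ψ₁ ∧
                    ∃ (ρ : ℝ) (τ₁ : E3 → ℝ), IsRegistered (Cb * η) 4 ρ S (atomsIn (μS S) 0 R) (LayeredHom (L₁ : E3 →L[ℝ] E3) w₁) Ψ₁ τ₁

/-- ★★ **(G♭ˣ) «GradReframingThinP aHi Λ θ s s'»** — re-typed (G♭): (Gˣ) in the coherent regime `η·R² < c₀` (some `c₀ > 0`). [this file, g38] -/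
def GradReframingThinP (aHi Λ θ s s' : ℝ) : Prop :=
  ∃ c₀ : ℝ, 0 < c₀ ∧ ∀ δ : ℝ, 0 < δ → ∀ a : ℝ, 0 < a → ∀ C₁ : ℝ, 0 ≤ C₁ → ∃ Cb : ℝ, 1 ≤ Cb ∧ ∃ η₁ : ℝ, 0 < η₁ ∧ ∃ R₁ : ℝ, 0 < R₁ ∧
    ∀ S : Set E3, IsDoorSetP aHi δ S → (∀ q ∈ S, IsTwoShellAffineGood θ S q) → HasQuadExcess C₁ S →
      ∀ η : ℝ, 0 < η → η ≤ η₁ → ∀ R : ℝ, R₁ ≤ R → η * R ^ 2 < c₀ →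
        (∀ D : ℝ, R ≤ D → NearHomH1BDE a s Λ η 4 D S (atomsIn (μS S) 0 D)) →
          ∀ (L : E3 ≃L[ℝ] E3) (w' : ℤ → E3) (Ψ' : E3 → E3) (τ' : E3 → ℝ), IsEquilChart a s Λ L w' →
            IsRegistered η 4 R S (atomsIn (μS S) 0 R) (LayeredHom (L : E3 →L[ℝ] E3) w') Ψ' τ' →
              ∀ (w : ℤ → E3) (Ψ₀ : E3 → E3), IsEquilChart a s Λ L w → Set.BijOn Ψ₀ S (LayeredHom (L : E3 →L[ℝ] E3) w) → IsBondIso S Ψ₀ →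
                ∃ (L₁ : E3 ≃L[ℝ] E3) (w₁ : ℤ → E3) (Ψ₁ : E3 → E3), IsEquilChart a s' Λ L₁ w₁ ∧
                  Set.BijOn Ψ₁ S (LayeredHom (L₁ : E3 →L[ℝ] E3) w₁) ∧ IsBondIso S Ψ₁ ∧
                    ∃ (ρ : ℝ) (τ₁ : E3 → ℝ), IsRegistered (Cb * η) 4 ρ S (atomsIn (μS S) 0 R) (LayeredHom (L₁ : E3 →L[ℝ] E3) w₁) Ψ₁ τ₁

/-- ★★ **(Λ♭ˣ) «ThinLaunderingPX aHi Λ θ s s'»** — re-typed (Λ♭) `ThinLaunderingP` (the line of record's piece): in the thin regime, given the datum at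
tolerance `s`, a bond-isomorphic chart on the datum's lattice and the energy input, there are a RE-FRAMED true-word equilibrium chart `LayeredHom L₁ w₁`
(`L₁` free, tolerance `s'`), a map `Ψ₁` registering `win R` into it at level `C_Λ·η` (free position scale) and a bijective bond isomorphism `Φ : S →
LayeredHom L₁ w₁`, LAYER-COMPATIBLE with `Ψ₁` on the good sites (`τ₁ x < 1/8`).  The structural dichotomy of the re-framing: GENERIC — an `h`-letter
of `S` within reach of the window pins the datum's reading to the true plane (misreading one `h`-layer costs `≥ c·R²` against the thin budget
`< 6.5·c₀·R`), `L₁ := L`; SPECIAL — the reach is all-`c` (locally cubic), `L₁ := L ∘ ĝ` with `ĝ` the point symmetry of the cubic germ carrying the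
chart's layer plane to `S`'s, conformal about `a` within `s + C·(C₁/R)^{1/2} ≤ s'` by the energy input.  Then laundering (F7 of part TL) as before.
TAME EXISTENCE + GARBAGE DETECTION + RE-FRAMING + TRANSFER · TRUE-expected (`s < s′`) · ATTACKABLE · IDEA-NAMED · L.  Why it might fail: the cubic
germ of an all-`c` reach is known only to `O((C₁/R)^{1/2})` (energy) — at `s′ = s` the re-framed chart can miss conformality by a hair; and the
letter-truth step needs `c₀ ≤ 0.03` (part TL (F7)(i)).  Sources: [this tree: `ThinLaunderingP` (TL), `excess_window_le_of_gsc` (N), `IsConfChart` (O)],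
[EMing2006 §2], [kruzik2019 p.55 Thm 1.1.12], [arXiv:1601.05968], [ConwaySloane1999 Ch. 1 §1.3]. [this file, g38] -/
def ThinLaunderingPX (aHi Λ θ s s' : ℝ) : Prop :=
  ∃ c₀ : ℝ, 0 < c₀ ∧ ∀ δ : ℝ, 0 < δ → ∀ a : ℝ, 0 < a → ∀ C₁ : ℝ, 0 ≤ C₁ → ∃ Cl : ℝ, 1 ≤ Cl ∧ ∃ η₁ : ℝ, 0 < η₁ ∧ ∃ R₁ : ℝ, 0 < R₁ ∧
    ∀ S : Set E3, IsDoorSetP aHi δ S → (∀ q ∈ S, IsTwoShellAffineGood θ S q) → HasQuadExcess C₁ S →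
      ∀ η : ℝ, 0 < η → η ≤ η₁ → ∀ R : ℝ, R₁ ≤ R → η * R ^ 2 < c₀ →
        (∀ D : ℝ, R ≤ D → NearHomH1BDE a s Λ η 4 D S (atomsIn (μS S) 0 D)) →
          ∀ (L : E3 ≃L[ℝ] E3) (w' : ℤ → E3) (Ψ' : E3 → E3) (τ' : E3 → ℝ), IsEquilChart a s Λ L w' →
            IsRegistered η 4 R S (atomsIn (μS S) 0 R) (LayeredHom (L : E3 →L[ℝ] E3) w') Ψ' τ' →
              ∀ (w : ℤ → E3) (Ψ₀ : E3 → E3), IsEquilChart a s Λ L w → Set.BijOn Ψ₀ S (LayeredHom (L : E3 →L[ℝ] E3) w) → IsBondIso S Ψ₀ →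
                ∃ (L₁ : E3 ≃L[ℝ] E3) (w₁ : ℤ → E3) (Ψ₁ : E3 → E3) (ρ : ℝ) (τ₁ : E3 → ℝ) (Φ : E3 → E3), IsEquilChart a s' Λ L₁ w₁ ∧
                  IsRegistered (Cl * η) 4 ρ S (atomsIn (μS S) 0 R) (LayeredHom (L₁ : E3 →L[ℝ] E3) w₁) Ψ₁ τ₁ ∧
                    Set.BijOn Φ S (LayeredHom (L₁ : E3 →L[ℝ] E3) w₁) ∧ IsBondIso S Φ ∧
                      ∀ x ∈ atomsIn (μS S) 0 R, τ₁ x < 1 / 8 →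
                        ∃ m : ℤ, Ψ₁ x ∈ layerOf (L₁ : E3 →L[ℝ] E3) w₁ m ∧ Φ x ∈ layerOf (L₁ : E3 →L[ℝ] E3) w₁ m

/-! ### XV.3  Glue of the re-typed sub-line (PROVED) -/

/-- ★★★ **(G♭ˣ) ⟸ (Λ♭ˣ) ∧ (Υ)(s′) (PROVED)** — launder-and-re-frame, then untwist IN THE RE-FRAMED CHART at level `κ := C_Λ·η ≤ κ₁` ((Υ) is generic in
the chart: instantiated at `(L₁, w₁)`, tolerance `s′`); `C♭ := C_U·C_Λ`, ceiling `min(η₁, κ₁/C_Λ)`, floor `max`. [this file, g38] -/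
theorem gradReframingThinP_of_laundering_untwist {aHi Λ θ s s' : ℝ} (hl : ThinLaunderingPX aHi Λ θ s s') (hu : LateralUntwistP aHi Λ θ s') :
    GradReframingThinP aHi Λ θ s s' := by
  obtain ⟨c₀, hc₀, Hl⟩ := hl
  refine ⟨c₀, hc₀, fun δ hδ a ha C₁ hC₁ => ?_⟩
  obtain ⟨Cl, hCl, η₁, hη₁, R₁, hR₁, H₁⟩ := Hl δ hδ a ha C₁ hC₁
  obtain ⟨Cu, hCu, κ₁, hκ₁, R₂, hR₂, H₂⟩ := hu δ hδ a ha
  have hCl0 : 0 < Cl := one_pos.trans_le hCl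
  refine ⟨Cu * Cl, one_le_mul_of_one_le_of_one_le hCu hCl, min η₁ (κ₁ / Cl), lt_min hη₁ (div_pos hκ₁ hCl0),
    max R₁ R₂, lt_max_of_lt_left hR₁, ?_⟩
  intro S hS hgood hQ η hη hηle R hR hthin hms L w' Ψ' τ' hE' hreg' w Ψ₀ hEw hbij hiso
  obtain ⟨L₁, w₁, Ψ₁, ρ, τ₁, Φ, hE₁, hr₁, hbΦ, hiΦ, hlay⟩ := H₁ S hS hgood hQ η hη (hηle.trans (min_le_left _ _)) R
    ((le_max_left _ _).trans hR) hthin hms L w' Ψ' τ' hE' hreg' w Ψ₀ hEw hbij hiso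
  have hκ : Cl * η ≤ κ₁ := by
    rw [mul_comm]
    exact (le_div_iff₀ hCl0).mp (hηle.trans (min_le_right _ _))
  obtain ⟨Φ₁, ρ₁, τ₂, hb₁, hi₁, hr₂⟩ := H₂ S hS hgood (Cl * η) (mul_pos hCl0 hη) hκ R ((le_max_right _ _).trans hR)
    L₁ w₁ Ψ₁ ρ τ₁ Φ hE₁ hr₁ hbΦ hiΦ hlay
  exact ⟨L₁, w₁, Φ₁, hE₁, hb₁, hi₁, ρ₁, τ₂, by rw [mul_assoc]; exact hr₂⟩

/-- ★★ **(Gˣ) ⟸ (G♯ˣ) ∧ (G♭ˣ) (PROVED)** — the regime dichotomy is exhaustive (`c₀` from (G♭ˣ)). [this file, g38] -/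
theorem gradReframingP_of_thick_thin {aHi Λ θ s s' : ℝ} (hT : GradReframingThickP aHi Λ θ s s') (ht : GradReframingThinP aHi Λ θ s s') :
    GradReframingP aHi Λ θ s s' := by
  obtain ⟨c₀, hc₀, Ht⟩ := ht
  intro δ hδ a ha C₁ hC₁
  obtain ⟨Ca, hCa, η₁, hη₁, R₁, hR₁, H₁⟩ := hT c₀ hc₀ δ hδ a ha C₁ hC₁
  obtain ⟨Cc, hCc, η₂, hη₂, R₂, hR₂, H₂⟩ := Ht δ hδ a ha C₁ hC₁
  refine ⟨max Ca Cc, le_max_of_le_left hCa, min η₁ η₂, lt_min hη₁ hη₂, max R₁ R₂, lt_max_of_lt_left hR₁, ?_⟩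
  intro S hS hgood hQ η hη hηle R hR hms L w' Ψ' τ' hE' hreg' w Ψ₀ hEw hbij hiso
  by_cases hc : c₀ ≤ η * R ^ 2
  · obtain ⟨L₁, w₁, Ψ₁, hE₁, hb₁, hi₁, ρ, τ₁, hr₁⟩ := H₁ S hS hgood hQ η hη (hηle.trans (min_le_left _ _)) R ((le_max_left _ _).trans hR) hc
      hms L w' Ψ' τ' hE' hreg' w Ψ₀ hEw hbij hiso
    exact ⟨L₁, w₁, Ψ₁, hE₁, hb₁, hi₁, ρ, τ₁, hr₁.mono (mul_le_mul_of_nonneg_right (le_max_left _ _) hη.le)⟩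
  · obtain ⟨L₁, w₁, Ψ₁, hE₁, hb₁, hi₁, ρ, τ₁, hr₁⟩ := H₂ S hS hgood hQ η hη (hηle.trans (min_le_right _ _)) R ((le_max_right _ _).trans hR)
      (not_le.mp hc) hms L w' Ψ' τ' hE' hreg' w Ψ₀ hEw hbij hiso
    exact ⟨L₁, w₁, Ψ₁, hE₁, hb₁, hi₁, ρ, τ₁, hr₁.mono (mul_le_mul_of_nonneg_right (le_max_right _ _) hη.le)⟩

/-- ★★ **(B2ˣ) ⟸ (Gˣ) ∧ (P) (PROVED)** — re-anchor by the window Poincaré mean in the re-framed chart (translation keeps `L₁`). [this file, g38] -/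
theorem bondIsoReframingP_of_grad_poincare {aHi Λ θ s s' : ℝ} (hG : GradReframingP aHi Λ θ s s') (hP : WindowPoincareP aHi) :
    BondIsoReframingP aHi Λ θ s s' := by
  intro δ hδ a ha C₁ hC₁
  obtain ⟨Cb, hCb, η₁, hη₁, R₁, hR₁, HG⟩ := hG δ hδ a ha C₁ hC₁
  obtain ⟨CP, hCP, R₂, hR₂, HP⟩ := hP δ hδ
  refine ⟨CP * Cb, one_le_mul_of_one_le_of_one_le hCP hCb, η₁, hη₁, max R₁ R₂, lt_max_of_lt_left hR₁, ?_⟩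
  intro S hS hgood hQ η hη hηle R hR hms L w' Ψ' τ' hE' hreg' w Ψ₀ hEw hbij hiso
  obtain ⟨L₁, w₁, Ψ₁, hE₁, hb₁, hi₁, ρ, τ₁, hr₁⟩ := HG S hS hgood hQ η hη hηle R ((le_max_left _ _).trans hR) hms L w' Ψ' τ' hE' hreg'
    w Ψ₀ hEw hbij hiso
  have hCbη : 0 ≤ Cb * η := mul_nonneg (zero_le_one.trans hCb) hη.le
  obtain ⟨t, ht⟩ := HP S hS R ((le_max_right _ _).trans hR) (fun x => x - Ψ₁ x) τ₁ (fun x hx p hp hd => by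
    show dist (p - Ψ₁ p) (x - Ψ₁ x) ≤ τ₁ x
    rw [dist_eq_norm, sub_sub_sub_comm, ← dist_eq_norm]
    exact hr₁.2.2.2.1 x hx p hp hd)
  have hpos : ∑ᶠ x ∈ atomsIn (μS S) 0 R, ‖x - (Ψ₁ x + t)‖ ^ 2 ≤ CP * Cb * η * R ^ 2 * nK (atomsIn (μS S) 0 R) := by
    have e : ∀ x : E3, ‖x - (Ψ₁ x + t)‖ = ‖x - Ψ₁ x - t‖ := fun x => by rw [sub_add_eq_sub_sub]
    simp only [e]
    refine ht.trans ?_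
    calc CP * R ^ 2 * ∑ᶠ x ∈ atomsIn (μS S) 0 R, τ₁ x ^ 2 ≤ CP * R ^ 2 * (Cb * η * nK (atomsIn (μS S) 0 R)) :=
          mul_le_mul_of_nonneg_left hr₁.2.2.2.2.1 (mul_nonneg (zero_le_one.trans hCP) (sq_nonneg R))
      _ = CP * Cb * η * R ^ 2 * nK (atomsIn (μS S) 0 R) := by ring
  refine ⟨L₁, fun m => w₁ m + t, fun x => Ψ₁ x + t, hE₁.translate t, ?_, hi₁.translate t, τ₁, ?_⟩
  · rw [layeredHom_add_const]
    exact bijOn_translate hb₁ t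
  · rw [layeredHom_add_const]
    exact hr₁.translate (by rw [mul_assoc]; exact le_mul_of_one_le_left hCbη hCP) t hpos

/-- ★★ **(A0♭⁺ˣ) ⟸ (B1)(s) ∧ (B2ˣ) ∧ (B4) (PROVED)** — on the datum the multi-scale hypothesis provides at `D = R`: (B1) transplants `S`'s word to the
datum's lattice, D1 (`exists_bijOn_bondIso_of_barlowCharts`) makes it a bijective bond isomorphism, (B2ˣ) RE-FRAMES and registers, (B4) gives
tear-freeness (both sets clean).  Ceiling `min`, floor `max`. [this file, g38] -/
theorem equilChartBondIsoPX_of_pieces {aHi Λ θ s s' : ℝ} (h1 : WordTransplantP aHi Λ θ s) (h2 : BondIsoReframingP aHi Λ θ s s')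
    (h4 : BondIsoTearFreeP aHi) : EquilChartBondIsoPX aHi Λ θ s s' := by
  intro δ hδ a ha C₁ hC₁
  obtain ⟨η₁, hη₁, R₁, hR₁, H1⟩ := h1 δ hδ a ha
  obtain ⟨Cb, hCb, η₂, hη₂, R₂, hR₂, H2⟩ := h2 δ hδ a ha C₁ hC₁
  refine ⟨Cb, hCb, min η₁ η₂, lt_min hη₁ hη₂, max R₁ R₂, lt_max_of_lt_left hR₁, ?_⟩
  intro S hS hgood hQ η hη hηle R hR hms
  obtain ⟨L, w', hE', Ψ', τ', hreg'⟩ := hms R le_rfl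
  obtain ⟨sw, hsw, Φ, hΦ⟩ := exists_barlowChart_of_isDoorSetP hS
  obtain ⟨w, ΦH, hEw, hΦH⟩ := H1 S hS hgood η hη (hηle.trans (min_le_left _ _)) R ((le_max_left _ _).trans hR) hms
    L w' Ψ' τ' hE' hreg' sw Φ hsw hΦ
  obtain ⟨Ψ₀, hbij₀, hiso₀⟩ := exists_bijOn_bondIso_of_barlowCharts hΦ hΦH
  obtain ⟨L₁, w₁, Ψ₁, hEw₁, hbij₁, hiso₁, τ₁, hreg₁⟩ := H2 S hS hgood hQ η hη (hηle.trans (min_le_right _ _)) R ((le_max_right _ _).trans hR)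
    hms L w' Ψ' τ' hE' hreg' w Ψ₀ hEw hbij₀ hiso₀
  obtain ⟨ht1, ht2⟩ := h4 S _ hS.2.2.1 hEw₁.2.2.2.1 Ψ₁ hbij₁ hiso₁
  exact ⟨L₁, w₁, hEw₁, Ψ₁, hbij₁, hiso₁, ht1, ht2, τ₁, hreg₁⟩

/-- ★★ **(A0⁺ˣ) ⟸ (A0♭⁺ˣ) ∧ (A0♯⁺)(s′) for `s ≤ s′` (PROVED)** — the level estimate (A0♯⁺) is generic in the chart: it takes the re-framed chart at
tolerance `s′` and the multi-scale hypothesis weakened to `s′` (`nearHomH1BDE_of_tol`). [this file, g38] -/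
theorem globalChartIsoRegistrationPX_of_bondIso_levels {aHi Λ θ s s' : ℝ} (hss : s ≤ s') (hb : EquilChartBondIsoPX aHi Λ θ s s')
    (hl : BondIsoLevelsP aHi Λ θ s') : GlobalChartIsoRegistrationPX aHi Λ θ s s' := by
  intro δ hδ a ha C₁ hC₁
  obtain ⟨Cb, hCb, η₁, hη₁, R₁, hR₁, Hb⟩ := hb δ hδ a ha C₁ hC₁
  obtain ⟨Cg, hCg, η₂, hη₂, R₂, hR₂, Hl⟩ := hl δ hδ a ha Cb hCb
  refine ⟨Cg, hCg, min η₁ η₂, lt_min hη₁ hη₂, max R₁ R₂, lt_max_of_lt_left hR₁, ?_⟩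
  intro S hS hgood hQ η hη hηle R hR hms
  obtain ⟨L, w, hLw, Ψ₀, hbij, hiso, ht1, ht2, hreg⟩ :=
    Hb S hS hgood hQ η hη (hηle.trans (min_le_left _ _)) R ((le_max_left _ _).trans hR) hms
  have hms' : ∀ D : ℝ, R ≤ D → NearHomH1BDE a s' Λ η 4 D S (atomsIn (μS S) 0 D) :=
    fun D hD => nearHomH1BDE_of_tol hss ha.le (hms D hD)
  exact ⟨L, w, hLw, Ψ₀,
    Hl S hS hgood η hη (hηle.trans (min_le_right _ _)) R ((le_max_right _ _).trans hR) hms' L w hLw Ψ₀ hbij hiso ht1 ht2 hreg, hiso⟩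

/-- ★ **(A0⁺ˣ) ⇒ (A0ˣ) (PROVED)**: forget the bond-isomorphism clause. [this file, g38] -/
theorem globalChartRegistrationPX_of_iso {aHi Λ θ s s' : ℝ} (h : GlobalChartIsoRegistrationPX aHi Λ θ s s') :
    GlobalChartRegistrationPX aHi Λ θ s s' := by
  intro δ hδ a ha C₁ hC₁
  obtain ⟨Cg, hCg, η₁, hη₁, R₁, hR₁, H⟩ := h δ hδ a ha C₁ hC₁
  refine ⟨Cg, hCg, η₁, hη₁, R₁, hR₁, fun S hS hgood hQ η hη hηle R hR hms => ?_⟩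
  obtain ⟨L, w, hLw, Ψ, hΨ, -⟩ := H S hS hgood hQ η hη hηle R hR hms
  exact ⟨L, w, hLw, Ψ, hΨ⟩

/-- ★★★ **(A0ˣ)(s,s′) ⟸ (B1)(s) ∧ (G♯ˣ) ∧ (Λ♭ˣ) ∧ (Υ)(s′) ∧ (A0♯⁺)(s′) at `aHi = 1`, `s ≤ s′` (PROVED)** — the re-typed sub-line composed ((P) =
`windowPoincareP_one`, (B4) = `bondIsoTearFreeP_one`). [this file, g38] -/
theorem globalChartRegistrationPX_of_subline {Λ θ s s' : ℝ} (hss : s ≤ s') (h1 : WordTransplantP 1 Λ θ s)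
    (hT : GradReframingThickP 1 Λ θ s s') (hl : ThinLaunderingPX 1 Λ θ s s') (hu : LateralUntwistP 1 Λ θ s')
    (hL : BondIsoLevelsP 1 Λ θ s') : GlobalChartRegistrationPX 1 Λ θ s s' :=
  globalChartRegistrationPX_of_iso (globalChartIsoRegistrationPX_of_bondIso_levels hss
    (equilChartBondIsoPX_of_pieces h1 (bondIsoReframingP_of_grad_poincare
      (gradReframingP_of_thick_thin hT (gradReframingThinP_of_laundering_untwist hl hu)) windowPoincareP_one) bondIsoTearFreeP_one) hL)

/-! ### XV.4  Nothing lost: the refuted pinned pieces imply their re-typings; (A0) implies the new node (PROVED) -/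

/-- ★ **(A0)(s′) ∧ `s ≤ s′` ⇒ (A0ˣ)(s,s′) (PROVED)**: the surviving node of architecture (II) implies the new node (ignore the energy input, weaken the
multi-scale hypothesis to `s′`). [this file, g38] -/
theorem globalChartRegistrationPX_of_globalChartRegistrationP {aHi Λ θ s s' : ℝ} (hss : s ≤ s') (h : GlobalChartRegistrationP aHi Λ θ s') :
    GlobalChartRegistrationPX aHi Λ θ s s' := by
  intro δ hδ a ha C₁ _
  obtain ⟨Cg, hCg, η₁, hη₁, R₁, hR₁, H⟩ := h δ hδ a ha
  refine ⟨Cg, hCg, η₁, hη₁, R₁, hR₁, fun S hS hgood _ η hη hηle R hR hms => ?_⟩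
  exact H S hS hgood η hη hηle R hR (fun D hD => nearHomH1BDE_of_tol hss ha.le (hms D hD))

/-- ★ **(G♯)(s) ∧ `s ≤ s′` ⇒ (G♯ˣ)(s,s′) (PROVED)**: a pinned chart on `L` at tolerance `s` is a re-framed chart (`L₁ := L`) at tolerance `s′`
(so the re-typing asks for LESS than the refuted piece, on FEWER configurations). [this file, g38] -/
theorem gradReframingThickP_of_pinned {aHi Λ θ s s' : ℝ} (hss : s ≤ s') (h : GradPinningThickP aHi Λ θ s) :
    GradReframingThickP aHi Λ θ s s' := by
  intro c₀ hc₀ δ hδ a ha C₁ _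
  obtain ⟨Cb, hCb, η₁, hη₁, R₁, hR₁, H⟩ := h c₀ hc₀ δ hδ a ha
  refine ⟨Cb, hCb, η₁, hη₁, R₁, hR₁, fun S hS hgood _ η hη hηle R hR hc hms L w' Ψ' τ' hE' hreg' w Ψ₀ hEw hbij hiso => ?_⟩
  obtain ⟨w₁, Ψ₁, hE₁, hb₁, hi₁, ρ, τ₁, hr₁⟩ := H S hS hgood η hη hηle R hR hc hms L w' Ψ' τ' hE' hreg' w Ψ₀ hEw hbij hiso
  exact ⟨L, w₁, Ψ₁, hE₁.of_tol hss ha.le, hb₁, hi₁, ρ, τ₁, hr₁⟩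

/-- ★ **(Λ♭)(s) ∧ `s ≤ s′` ⇒ (Λ♭ˣ)(s,s′) (PROVED)**: likewise for the laundering piece. [this file, g38] -/
theorem thinLaunderingPX_of_pinned {aHi Λ θ s s' : ℝ} (hss : s ≤ s') (h : ThinLaunderingP aHi Λ θ s) : ThinLaunderingPX aHi Λ θ s s' := by
  obtain ⟨c₀, hc₀, H⟩ := h
  refine ⟨c₀, hc₀, fun δ hδ a ha C₁ _ => ?_⟩
  obtain ⟨Cl, hCl, η₁, hη₁, R₁, hR₁, H₁⟩ := H δ hδ a ha
  refine ⟨Cl, hCl, η₁, hη₁, R₁, hR₁, fun S hS hgood _ η hη hηle R hR hthin hms L w' Ψ' τ' hE' hreg' w Ψ₀ hEw hbij hiso => ?_⟩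
  obtain ⟨w₁, Ψ₁, ρ, τ₁, Φ, hE₁, hr₁, hbΦ, hiΦ, hlay⟩ := H₁ S hS hgood η hη hηle R hR hthin hms L w' Ψ' τ' hE' hreg' w Ψ₀ hEw hbij hiso
  exact ⟨L, w₁, Ψ₁, ρ, τ₁, Φ, hE₁.of_tol hss ha.le, hr₁, hbΦ, hiΦ, hlay⟩

/-- ★ **(A0⁺)(s′) ∧ `s ≤ s′` ⇒ (A0⁺ˣ)(s,s′) (PROVED)**: the refuted frame-free form implies its re-typing too (so the re-typing asks for no more than
before — it asks for less, on fewer configurations). [this file, g38] -/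
theorem globalChartIsoRegistrationPX_of_globalChartIsoRegistrationP {aHi Λ θ s s' : ℝ} (hss : s ≤ s')
    (h : GlobalChartIsoRegistrationP aHi Λ θ s') : GlobalChartIsoRegistrationPX aHi Λ θ s s' := by
  intro δ hδ a ha C₁ _
  obtain ⟨Cg, hCg, η₁, hη₁, R₁, hR₁, H⟩ := h δ hδ a ha
  refine ⟨Cg, hCg, η₁, hη₁, R₁, hR₁, fun S hS hgood _ η hη hηle R hR hms => ?_⟩
  exact H S hS hgood η hη hηle R hR (fun D hD => nearHomH1BDE_of_tol hss ha.le (hms D hD))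

/-- ★ **non-vacuity of the re-typed outputs**: an equilibrium chart, as a configuration, carries re-framed data at level `0` for every frame tolerance
`s′ ≥ s` — itself, `L₁ := L`, the identity (part TH `pinning_data_self`). [this file, g38] -/
theorem reframing_data_self {a s s' Λ : ℝ} (hss : s ≤ s') (ha : 0 ≤ a) {L : E3 ≃L[ℝ] E3} {w : ℤ → E3} (h : IsEquilChart a s Λ L w) (R : ℝ) :
    ∃ (L₁ : E3 ≃L[ℝ] E3) (w₁ : ℤ → E3) (Ψ₁ : E3 → E3), IsEquilChart a s' Λ L₁ w₁ ∧
      Set.BijOn Ψ₁ (LayeredHom (L : E3 →L[ℝ] E3) w) (LayeredHom (L₁ : E3 →L[ℝ] E3) w₁) ∧ IsBondIso (LayeredHom (L : E3 →L[ℝ] E3) w) Ψ₁ ∧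
        ∃ τ : E3 → ℝ, IsRegistered 0 4 R (LayeredHom (L : E3 →L[ℝ] E3) w) (atomsIn (μS (LayeredHom (L : E3 →L[ℝ] E3) w)) 0 R)
          (LayeredHom (L₁ : E3 →L[ℝ] E3) w₁) Ψ₁ τ :=
  ⟨L, w, fun x => x, h.of_tol hss ha, Set.bijOn_id _, isBondIso_self _, fun _ => 0, isRegistered_self 4 R (atomsIn_subset _ R)⟩

end Summit.AtomisticToContinuum.Crystallization.Theorems.ChartedZeroExcessLayeredLatticeLiouville

end
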